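import Summits.BirchSwinnertonDyer.BirchSwinnertonDyer.Theses.SmallImageMuTransfer
import Summits.BirchSwinnertonDyer.BirchSwinnertonDyer.Theorems.SmallImageMuTransferSchneiderX9RankOneOfOrderOne
import HarnessLib

/-!
# Crux `SchneiderX9RankOne` (stmt-BirchSwinnertonDyer-19631) — line `birth` (skeleton of record
# c23ac36b, planner bsd-smallim-plan g2), re-typed by the line lead bsd-line-k6-p3

Composition: `SchneiderX9RankOne ⇐ stub_orderOne + stub_schneider_of_orderOne`.

* `stub_orderOne` — OPEN (conjecture-grade): on every rank-`1` X9 pair `(E, p)` and every newform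
  `f` of `E`, `[T¹] L_p(f, α, T) ≠ 0` (the analytic half of Schneider's conjecture in rank one;
  equivalently `ord_T L_p(E,T) = 1`, since `L_p(0) = 0`, `L_p ≠ 0` and `ord_T L_p` is odd are tree
  theorems).  It is the X9-restriction of crux `PAdicOrderRankOneR4` (stmt-BirchSwinnertonDyer-0515).
* `stub_publishedInputsRankOne` — the three PUBLISHED named facts the Perrin-Riou step consumes
  (Perrin-Riou 1987 Cor. 1.8, Gross–Zagier–Kolyvagin, modularity as parametrisation data); all three
  are conjuncts of the route's support item `PublishedInputsX9` (stmt-BirchSwinnertonDyer-19632).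
* `stub_schneider_of_orderOne` — the registered signature, PROVED here from
  `stub_publishedInputsRankOne` by the landed helper
  `Rank1Residual.schneider_of_orderOne_of_perrinRiou` (p415447).
-/

set_option linter.dupNamespace false
set_option autoImplicit false

noncomputable section

open scoped Classical MatrixGroups ModularForm

open CongruenceSubgroup WeierstrassCurve
open Literature.NumberTheory.EllipticCurves Literature.NumberTheory.EllipticCurves.ModularForms

namespace Summit.BirchSwinnertonDyer.BirchSwinnertonDyer.SchneiderX9RankOneLine

/-- **stub_orderOne (OPEN).** On every rank-`1` X9 pair and every newform `f` of the curve,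
`[T¹] L_p(f, α, T) ≠ 0`. Registered signature verbatim (skeleton c23ac36b). -/
theorem stub_orderOne : ∀ (W : WeierstrassCurve ℚ) [W.IsElliptic] [W.IsGloballyMinimal] (p : ℕ)
    [Fact p.Prime] {N : ℕ} [NeZero N] (f : CuspForm (Gamma0 N) 2),
    Summit.BirchSwinnertonDyer.BirchSwinnertonDyer.Rank1Residual.ClassX9 W p → W.analyticRank = 1 →
    IsNewformOf W f → PowerSeries.coeff 1 (padicLFunction f (unitRoot W p : ℚ_[p])) ≠ 0 := by
  sorry

/-- **stub_publishedInputsRankOne (PUBLISHED, not proved in the tree).** Perrin-Riou 1987 §1.4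
Cor. 1.8 (rank-one leading terms), Gross–Zagier–Kolyvagin (rank = analytic rank ≤ 1, Ш finite) and
modularity (parametrisation data) — conjuncts 5, 8, 6 of `Theses.SmallImageMuTransfer.PublishedInputsX9`. -/
theorem stub_publishedInputsRankOne :
    perrinRiou_rankOne_leadingTerms ∧ rank_eq_analyticRank_of_analyticRank_le_one ∧
      nonempty_modularParametrizationData := by
  sorry

/-- **stub_schneider_of_orderOne (registered signature; CLOSED modulo the published inputs).**
`[T¹] L_p ≠ 0` for every newform ⟹ Schneider's non-degeneracy for every canonical height datum, on
the rank-`1` X9 pairs — `Rank1Residual.schneider_of_orderOne_of_perrinRiou` (p415447). -/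
theorem stub_schneider_of_orderOne : ∀ (W : WeierstrassCurve ℚ) [W.IsElliptic] [W.IsGloballyMinimal]
    (p : ℕ) [Fact p.Prime],
    Summit.BirchSwinnertonDyer.BirchSwinnertonDyer.Rank1Residual.ClassX9 W p → W.analyticRank = 1 →
    (∀ {N : ℕ} [NeZero N] (f : CuspForm (Gamma0 N) 2), IsNewformOf W f →
      PowerSeries.coeff 1 (padicLFunction f (unitRoot W p : ℚ_[p])) ≠ 0) →
    ∀ Dh : WeierstrassCurve.PAdicHeightData W p, Dh.IsCanonical →
      WeierstrassCurve.SchneiderConjecture Dh :=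
  Rank1Residual.schneider_of_orderOne_of_perrinRiou stub_publishedInputsRankOne.1
    stub_publishedInputsRankOne.2.1 stub_publishedInputsRankOne.2.2

/-- **Composition: the crux by name.** -/
theorem SchneiderX9RankOne_of : Theses.SmallImageMuTransfer.SchneiderX9RankOne := by
  unfold Theses.SmallImageMuTransfer.SchneiderX9RankOne
  intro W _ _ p _ hX9 han Dh hDh
  exact stub_schneider_of_orderOne W p hX9 han (fun f hf ↦ stub_orderOne W p f hX9 han hf) Dh hDh

end Summit.BirchSwinnertonDyer.BirchSwinnertonDyer.SchneiderX9RankOneLine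

end
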